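import Literature.NumberTheory.LFunctions.KMVAfeWeightRealForm
import HarnessLib

/-!
# KMV 2000 (22)/(15): the all-order AFE weight decays faster than any negative power —
# Rankin's bound `|W_{ij}(a₁,a₂;y)| ≤ C y^{−A} (1+|a₁|)^i (1+|a₂|)^j` for the real form `logCutoffW`

Source: E. Kowalski, P. Michel, J. VanderKam, J. reine angew. Math. 526 (2000), (22) p. 12 («decays
faster than any negative power of y») and (15) p. 9 («V_total(y) = O_N(y^{−N})»)
[held: paper:doi-10-1515-crll-2000-074]. Cell landau-siegel / ls-inputs, line H-AFE2 (K-INPUTS-11 (1)),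
seat ls-inputs-Hafe-lead g1: stub **T5** `stub_logCutoffW_bound` of the fact skeleton `log-fricke-split`.
Proofs only (no definitions, no named facts).

The argument is Rankin's trick on the closed real form
`W_{ij}(a₁,a₂;y) = ∫_{x₁>0} e^{−x₁}(a₁+log x₁)^i ∫_{x₂>y/x₁} e^{−x₂}(a₂+log x₂)^j` (`KMV2000.logCutoffW`):
on the range of the inner integral `x₁x₂/y > 1`, so `1 ≤ (x₁x₂/y)^A` for every `A ≥ 0`, whence
`|W_{ij}| ≤ y^{−A} M_A(a₁,i) M_A(a₂,j)` with `M_A(a,i) = ∫_0^∞ x^A e^{−x}|a+log x|^i dx ≤ (1+|a|)^i C_A,i`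
(`|a + log x| ≤ (1+|a|)(1+|log x|)`, `(1+|log x|)^i ≤ 2^i(1+|log x|^i)` — the latter is the tree's
`BMOInv.one_add_pow_le_two_pow_mul`, inlined here to keep the imports light).

* `KMV2000.abs_logCutoffW_le` — the bound with an explicit constant;
* `KMV2000.logCutoffW_bound_all` — the registered quantifier shape of stub T5 (verbatim).

No claim about Landau–Siegel zeros.
-/

noncomputable section

open scoped Real
open Set MeasureTheory

namespace Literature.NumberTheory.LFunctions.KMV2000

/-! ### Pointwise inequalities -/

/-- `|a + log x|^i ≤ (1+|a|)^i (1+|log x|)^i`. [cite: KowalskiMichelVanderKam2000, (21) p. 12] -/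
theorem abs_add_log_pow_le (a x : ℝ) (i : ℕ) :
    |a + Real.log x| ^ i ≤ (1 + |a|) ^ i * (1 + |Real.log x|) ^ i := by
  rw [← mul_pow]
  refine pow_le_pow_left₀ (abs_nonneg _) ?_ i
  calc |a + Real.log x| ≤ |a| + |Real.log x| := abs_add_le _ _
    _ ≤ (1 + |a|) * (1 + |Real.log x|) := by
        nlinarith [abs_nonneg a, abs_nonneg (Real.log x), mul_nonneg (abs_nonneg a) (abs_nonneg (Real.log x))]

/-! ### The moment `M_A(a,i) = ∫_0^∞ x^A e^{−x}|a+log x|^i dx` and its dominator -/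

/-- The dominator `x^A e^{−x} 2^i (1 + |log x|^i)` is integrable on `(0,∞)` for `A ≥ 0`.
[cite: KowalskiMichelVanderKam2000, (22) p. 12] -/
theorem integrableOn_rankinDominator (i : ℕ) {A : ℝ} (hA : 0 ≤ A) :
    IntegrableOn (fun x : ℝ ↦ x ^ A * (Real.exp (-x) * (2 ^ i * (1 + |Real.log x| ^ i)))) (Ioi 0) := by
  have h0 := integrableOn_rpow_mul_expLogPow (c := 1) one_pos 0 (σ := A) (by linarith)
  have hi := integrableOn_rpow_mul_expLogPow (c := 1) one_pos i (σ := A) (by linarith)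
  simp only [Real.log_one, zero_add, pow_zero, mul_one] at h0 hi
  have h := (h0.add hi).const_mul ((2 : ℝ) ^ i)
  refine IntegrableOn.congr_fun h (fun x _ ↦ ?_) measurableSet_Ioi
  simp only [Pi.add_apply]
  ring

/-- **The moment bound**: for `A ≥ 0`, `x ↦ x^A e^{−x}|a + log x|^i` is integrable on `(0,∞)` and
`∫_0^∞ x^A e^{−x}|a+log x|^i dx ≤ (1+|a|)^i · C_{A,i}` with `C_{A,i} = ∫_0^∞ x^A e^{−x} 2^i(1+|log x|^i) dx`.
[cite: KowalskiMichelVanderKam2000, (22) p. 12] -/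
theorem integral_rpow_exp_abs_log_pow_le (a : ℝ) (i : ℕ) {A : ℝ} (hA : 0 ≤ A) :
    IntegrableOn (fun x : ℝ ↦ x ^ A * (Real.exp (-x) * |a + Real.log x| ^ i)) (Ioi 0) ∧
    ∫ x in Ioi (0 : ℝ), x ^ A * (Real.exp (-x) * |a + Real.log x| ^ i) ≤
      (1 + |a|) ^ i * ∫ x in Ioi (0 : ℝ), x ^ A * (Real.exp (-x) * (2 ^ i * (1 + |Real.log x| ^ i))) := by
  have hint : IntegrableOn (fun x : ℝ ↦ x ^ A * (Real.exp (-x) * |a + Real.log x| ^ i)) (Ioi 0) := by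
    have h := integrableOn_rpow_mul_expLogPow (c := Real.exp a) (Real.exp_pos a) i (σ := A) (by linarith)
    simpa only [Real.log_exp] using h
  refine ⟨hint, ?_⟩
  rw [← integral_const_mul]
  refine setIntegral_mono_on hint ((integrableOn_rankinDominator i hA).const_mul _) measurableSet_Ioi
    fun x hx ↦ ?_
  have hx : (0 : ℝ) < x := hx
  have h1 := abs_add_log_pow_le a x i
  -- `(1 + L)^i ≤ 2^i (1 + L^i)` for `L = |log x| ≥ 0` (the tree's `BMOInv.one_add_pow_le_two_pow_mul`, inlined)
  have h2 : (1 + |Real.log x|) ^ i ≤ 2 ^ i * (1 + |Real.log x| ^ i) := by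
    have hL : 0 ≤ |Real.log x| := abs_nonneg _
    rcases le_total |Real.log x| 1 with h | h
    · calc (1 + |Real.log x|) ^ i ≤ (2 : ℝ) ^ i := pow_le_pow_left₀ (by positivity) (by linarith) i
        _ ≤ 2 ^ i * (1 + |Real.log x| ^ i) := le_mul_of_one_le_right (by positivity) (by
            have := pow_nonneg hL i; linarith)
    · calc (1 + |Real.log x|) ^ i ≤ (2 * |Real.log x|) ^ i :=
            pow_le_pow_left₀ (by positivity) (by linarith) i
        _ = 2 ^ i * |Real.log x| ^ i := mul_pow _ _ _
        _ ≤ 2 ^ i * (1 + |Real.log x| ^ i) := by gcongr; linarith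
  have hxA : 0 ≤ x ^ A := Real.rpow_nonneg hx.le A
  have hex : 0 ≤ Real.exp (-x) := (Real.exp_pos _).le
  calc x ^ A * (Real.exp (-x) * |a + Real.log x| ^ i)
      ≤ x ^ A * (Real.exp (-x) * ((1 + |a|) ^ i * (1 + |Real.log x|) ^ i)) := by gcongr
    _ ≤ x ^ A * (Real.exp (-x) * ((1 + |a|) ^ i * (2 ^ i * (1 + |Real.log x| ^ i)))) := by gcongr
    _ = (1 + |a|) ^ i * (x ^ A * (Real.exp (-x) * (2 ^ i * (1 + |Real.log x| ^ i)))) := by ring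

/-! ### Rankin's trick on the inner and outer integrals -/

/-- **Inner tail (Rankin)**: for `y > 0`, `x₁ > 0`, `A ≥ 0`,
`|∫_{x₂ > y/x₁} e^{−x₂}(a + log x₂)^j dx₂| ≤ (x₁/y)^A ∫_0^∞ x₂^A e^{−x₂}|a+log x₂|^j dx₂`
(`1 ≤ (x₁x₂/y)^A` on the range). [cite: KowalskiMichelVanderKam2000, (22) p. 12] -/
theorem abs_inner_tail_le (a : ℝ) (j : ℕ) {A y x₁ : ℝ} (hA : 0 ≤ A) (hy : 0 < y) (hx₁ : 0 < x₁) :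
    |∫ x₂ in Ioi (y / x₁), Real.exp (-x₂) * (a + Real.log x₂) ^ j| ≤
      (x₁ / y) ^ A * ∫ x₂ in Ioi (0 : ℝ), x₂ ^ A * (Real.exp (-x₂) * |a + Real.log x₂| ^ j) := by
  obtain ⟨hint, -⟩ := integral_rpow_exp_abs_log_pow_le a j hA
  have hyx : 0 < y / x₁ := div_pos hy hx₁
  -- `|∫_{Ioi (y/x₁)} E| ≤ ∫_{Ioi (y/x₁)} |E| ≤ ∫_{Ioi (y/x₁)} (x₁x₂/y)^A |E| ≤ (x₁/y)^A ∫_{Ioi 0} x₂^A |E|`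
  have hsub : Ioi (y / x₁) ⊆ Ioi (0 : ℝ) := Ioi_subset_Ioi hyx.le
  have hint' : IntegrableOn (fun x₂ : ℝ ↦ (x₁ / y) ^ A * (x₂ ^ A * (Real.exp (-x₂) * |a + Real.log x₂| ^ j)))
      (Ioi (y / x₁)) := (hint.mono_set hsub).const_mul _
  calc |∫ x₂ in Ioi (y / x₁), Real.exp (-x₂) * (a + Real.log x₂) ^ j|
      ≤ ∫ x₂ in Ioi (y / x₁), |Real.exp (-x₂) * (a + Real.log x₂) ^ j| := by
        rw [← Real.norm_eq_abs]
        exact (norm_integral_le_integral_norm _).trans (le_of_eq rfl)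
    _ ≤ ∫ x₂ in Ioi (y / x₁), (x₁ / y) ^ A * (x₂ ^ A * (Real.exp (-x₂) * |a + Real.log x₂| ^ j)) := by
        refine integral_mono_of_nonneg (ae_of_all _ fun _ ↦ abs_nonneg _) hint' ?_
        refine (ae_restrict_iff' measurableSet_Ioi).mpr (ae_of_all _ fun x₂ hx₂ ↦ ?_)
        have hx₂ : y / x₁ < x₂ := hx₂
        have hx₂0 : 0 < x₂ := lt_trans hyx hx₂
        have hone : 1 ≤ (x₁ / y) ^ A * x₂ ^ A := by
          rw [← Real.mul_rpow (div_pos hx₁ hy).le hx₂0.le]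
          refine Real.one_le_rpow ?_ hA
          rw [div_mul_eq_mul_div, le_div_iff₀ hy, one_mul]
          have := (div_lt_iff₀ hx₁).mp hx₂
          linarith
        dsimp only
        rw [abs_mul, abs_of_pos (Real.exp_pos _), abs_pow]
        have hnn : 0 ≤ Real.exp (-x₂) * |a + Real.log x₂| ^ j := by positivity
        calc Real.exp (-x₂) * |a + Real.log x₂| ^ j = 1 * (Real.exp (-x₂) * |a + Real.log x₂| ^ j) := by ring
          _ ≤ ((x₁ / y) ^ A * x₂ ^ A) * (Real.exp (-x₂) * |a + Real.log x₂| ^ j) :=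
              mul_le_mul_of_nonneg_right hone hnn
          _ = (x₁ / y) ^ A * (x₂ ^ A * (Real.exp (-x₂) * |a + Real.log x₂| ^ j)) := by ring
    _ ≤ ∫ x₂ in Ioi (0 : ℝ), (x₁ / y) ^ A * (x₂ ^ A * (Real.exp (-x₂) * |a + Real.log x₂| ^ j)) := by
        refine setIntegral_mono_set (hint.const_mul _) ?_ (ae_of_all _ hsub)
        refine (ae_restrict_iff' measurableSet_Ioi).mpr (ae_of_all _ fun x₂ hx₂ ↦ ?_)
        have hx₂ : (0 : ℝ) < x₂ := hx₂
        have : 0 ≤ (x₁ / y) ^ A := Real.rpow_nonneg (div_pos hx₁ hy).le A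
        positivity
    _ = (x₁ / y) ^ A * ∫ x₂ in Ioi (0 : ℝ), x₂ ^ A * (Real.exp (-x₂) * |a + Real.log x₂| ^ j) :=
        integral_const_mul _ _

/-- **Rankin's bound for the real-form weight, explicit constant**: for `A ≥ 0`, all `a₁ a₂` and `y > 0`,
`|W_{ij}(a₁,a₂;y)| ≤ y^{−A} · M_A(a₁,i) · M_A(a₂,j) ≤ C_{A,i}C_{A,j} · y^{−A} (1+|a₁|)^i (1+|a₂|)^j`.
[cite: KowalskiMichelVanderKam2000, (22) p. 12 and (15) p. 9] -/
theorem abs_logCutoffW_le (i j : ℕ) {A : ℝ} (hA : 0 ≤ A) (a₁ a₂ : ℝ) {y : ℝ} (hy : 0 < y) :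
    |logCutoffW i j a₁ a₂ y| ≤
      ((∫ x in Ioi (0 : ℝ), x ^ A * (Real.exp (-x) * (2 ^ i * (1 + |Real.log x| ^ i)))) *
        ∫ x in Ioi (0 : ℝ), x ^ A * (Real.exp (-x) * (2 ^ j * (1 + |Real.log x| ^ j)))) *
      y ^ (-A) * (1 + |a₁|) ^ i * (1 + |a₂|) ^ j := by
  set C₁ : ℝ := ∫ x in Ioi (0 : ℝ), x ^ A * (Real.exp (-x) * (2 ^ i * (1 + |Real.log x| ^ i))) with hC₁
  set C₂ : ℝ := ∫ x in Ioi (0 : ℝ), x ^ A * (Real.exp (-x) * (2 ^ j * (1 + |Real.log x| ^ j))) with hC₂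
  set M₂ : ℝ := ∫ x₂ in Ioi (0 : ℝ), x₂ ^ A * (Real.exp (-x₂) * |a₂ + Real.log x₂| ^ j) with hM₂
  obtain ⟨hint₁, hM₁le⟩ := integral_rpow_exp_abs_log_pow_le a₁ i hA
  obtain ⟨hint₂, hM₂le⟩ := integral_rpow_exp_abs_log_pow_le a₂ j hA
  have hM₂nn : 0 ≤ M₂ := setIntegral_nonneg measurableSet_Ioi fun x hx ↦ by
    have hx : (0 : ℝ) < x := hx; positivity
  have hC₂nn : 0 ≤ C₂ := setIntegral_nonneg measurableSet_Ioi fun x hx ↦ by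
    have hx : (0 : ℝ) < x := hx; positivity
  -- the outer dominator `|E₁(x₁)| (x₁/y)^A M₂ = y^{-A} M₂ · x₁^A |E₁(x₁)|`
  have hdom_int : IntegrableOn (fun x₁ : ℝ ↦ y ^ (-A) * M₂ *
      (x₁ ^ A * (Real.exp (-x₁) * |a₁ + Real.log x₁| ^ i))) (Ioi 0) := hint₁.const_mul _
  have hmain : |logCutoffW i j a₁ a₂ y| ≤ y ^ (-A) * M₂ *
      ∫ x₁ in Ioi (0 : ℝ), x₁ ^ A * (Real.exp (-x₁) * |a₁ + Real.log x₁| ^ i) := by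
    rw [logCutoffW, ← integral_const_mul]
    calc |∫ x₁ in Ioi (0 : ℝ), Real.exp (-x₁) * (a₁ + Real.log x₁) ^ i *
            ∫ x₂ in Ioi (y / x₁), Real.exp (-x₂) * (a₂ + Real.log x₂) ^ j|
        ≤ ∫ x₁ in Ioi (0 : ℝ), |Real.exp (-x₁) * (a₁ + Real.log x₁) ^ i *
            ∫ x₂ in Ioi (y / x₁), Real.exp (-x₂) * (a₂ + Real.log x₂) ^ j| := by
          rw [← Real.norm_eq_abs]
          exact (norm_integral_le_integral_norm _).trans (le_of_eq rfl)
      _ ≤ ∫ x₁ in Ioi (0 : ℝ), y ^ (-A) * M₂ * (x₁ ^ A * (Real.exp (-x₁) * |a₁ + Real.log x₁| ^ i)) := by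
          refine integral_mono_of_nonneg (ae_of_all _ fun _ ↦ abs_nonneg _) hdom_int ?_
          refine (ae_restrict_iff' measurableSet_Ioi).mpr (ae_of_all _ fun x₁ hx₁ ↦ ?_)
          have hx₁ : (0 : ℝ) < x₁ := hx₁
          have hin := abs_inner_tail_le a₂ j hA hy hx₁
          dsimp only
          rw [abs_mul, abs_mul, abs_of_pos (Real.exp_pos _), abs_pow]
          have hnn : 0 ≤ Real.exp (-x₁) * |a₁ + Real.log x₁| ^ i := by positivity
          have hpow : (x₁ / y) ^ A = y ^ (-A) * x₁ ^ A := by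
            rw [Real.div_rpow hx₁.le hy.le, Real.rpow_neg hy.le, div_eq_inv_mul]
          calc Real.exp (-x₁) * |a₁ + Real.log x₁| ^ i *
                |∫ x₂ in Ioi (y / x₁), Real.exp (-x₂) * (a₂ + Real.log x₂) ^ j|
              ≤ Real.exp (-x₁) * |a₁ + Real.log x₁| ^ i * ((x₁ / y) ^ A * M₂) :=
                mul_le_mul_of_nonneg_left hin hnn
            _ = y ^ (-A) * M₂ * (x₁ ^ A * (Real.exp (-x₁) * |a₁ + Real.log x₁| ^ i)) := by
                rw [hpow]; ring
  have hyA : 0 ≤ y ^ (-A) := Real.rpow_nonneg hy.le _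
  have hM₁nn : 0 ≤ ∫ x₁ in Ioi (0 : ℝ), x₁ ^ A * (Real.exp (-x₁) * |a₁ + Real.log x₁| ^ i) :=
    setIntegral_nonneg measurableSet_Ioi fun x hx ↦ by
      have hx : (0 : ℝ) < x := hx; positivity
  calc |logCutoffW i j a₁ a₂ y|
      ≤ y ^ (-A) * M₂ * ∫ x₁ in Ioi (0 : ℝ), x₁ ^ A * (Real.exp (-x₁) * |a₁ + Real.log x₁| ^ i) := hmain
    _ ≤ y ^ (-A) * ((1 + |a₂|) ^ j * C₂) * ((1 + |a₁|) ^ i * C₁) := by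
        gcongr
    _ = C₁ * C₂ * y ^ (-A) * (1 + |a₁|) ^ i * (1 + |a₂|) ^ j := by ring

/-- Stub **T5** of the fact skeleton `log-fricke-split` (crux workfile
`Cruxes/BeyondDiagonalBeatsQuarter/Lines/log_fricke_split.lean` on stmt-Parity-20343), in its registered
quantifier shape: for all `i j` and `A ≥ 0` there is `C` with `|W_{ij}(a₁,a₂;y)| ≤ C y^{−A}(1+|a₁|)^i(1+|a₂|)^j`
for all `a₁ a₂` and `y > 0`. [cite: KowalskiMichelVanderKam2000, (22) p. 12 and (15) p. 9] -/
theorem logCutoffW_bound_all :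
    ∀ (i j : ℕ) (A : ℝ), 0 ≤ A → ∃ C : ℝ, ∀ (a₁ a₂ y : ℝ), 0 < y →
      |KMV2000.logCutoffW i j a₁ a₂ y| ≤ C * y ^ (-A) * (1 + |a₁|) ^ i * (1 + |a₂|) ^ j :=
  fun i j _ hA ↦ ⟨_, fun a₁ a₂ _ hy ↦ abs_logCutoffW_le i j hA a₁ a₂ hy⟩

end Literature.NumberTheory.LFunctions.KMV2000

end
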